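import Mathlib

/-!
# `GrenetZeon.DualUnipotentThreeHalves` (stmt-ValiantsHypothesis-24318), LINE β `half_speed`, K1 (ii-ARITH) (desk g14 #332):
# ALLOCATION / PACKING ARITHMETIC for the chain loop of `stub_halfSpeedLaw_of_irr` — matrix-free ℕ atoms

(ii-ARITH) hand val-port-2 g2; consumer = the K1 loop writer val-port-3 g2 (composition chain of ✓ `exists_block_conj`, seams ✓
`exists_halfSpeed_seam`, leaves ✓ `exists_kill_leaf` / `exists_certify_leaf`).  Data of the loop: block sizes `d t` with `Σ d t = D`, a
target height `Θ` (`1 ≤ Θ ≤ D`), the C⁺ constant `C`.  The packing of val-port-2 g2's bus line 19:58:03Z: a block is FAT iff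
`4D ≤ Θ·d t` — certified at height `Θ_t := Θ·d t/(4D) ≥ 1` with `Θ_t·codim_t ≤ C·(d t)²`; the other blocks are merged greedily into KILL
groups of size `< 8D/Θ` (height `0`, `codim ≤ g²`).  The atoms below give: (A1) the certified heights sum to `≤ Θ/4`; (A2) there are
`≤ Θ/4`-ish fat blocks (`4D·#fat ≤ Θ·D`); (A3) each fat block costs `Θ·codim_t ≤ 8·C·D·d t`; (A4) kill groups of size `< B` cost
`Σ g² ≤ B·Σ g` (applied with `B = 8D/Θ + 1`).  The composite inequality is typed in the loop writer's own indexing (port-3's call).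

Honest framing.  Pure arithmetic (`--supports stmt-ValiantsHypothesis-24318 --as helper`); proves nothing about K1, `HalfSpeedIrrLaw`, R2,
the crux, 8062 or `VP ≠ VNP` — all OPEN / NOT proved. [desk #332; β food table]
-/

set_option linter.dupNamespace false
set_option autoImplicit false

namespace Summit.ValiantsHypothesis.ValiantsHypothesis.Theorems.GrenetZeon.HalfSpeed

open scoped BigOperators

/-! ## (A0) floor sums -/

/-- **Floor of a sum dominates the sum of floors**: `Σ_t (a t / m) ≤ (Σ_t a t) / m`. -/
theorem sum_div_le_sum_div {ι : Type*} (s : Finset ι) (a : ι → ℕ) (m : ℕ) :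
    ∑ t ∈ s, a t / m ≤ (∑ t ∈ s, a t) / m := by
  rcases Nat.eq_zero_or_pos m with hm | hm
  · subst hm; simp
  rw [Nat.le_div_iff_mul_le hm, Finset.sum_mul]
  exact Finset.sum_le_sum fun t _ => Nat.div_mul_le_self (a t) m

/-! ## (A1) the certified heights -/

/-- **(A1) Heights.**  With `Θ_t := Θ·d t/(k·D)` and `Σ d t = D > 0`: `Σ_t Θ_t ≤ Θ / k` (over ANY subfamily `s` of the blocks). -/
theorem sum_heights_le {ι : Type*} (s univ : Finset ι) (hs : s ⊆ univ) (d : ι → ℕ) (D Θ k : ℕ)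
    (hD : ∑ t ∈ univ, d t = D) (hDpos : 0 < D) :
    ∑ t ∈ s, Θ * d t / (k * D) ≤ Θ / k := by
  calc ∑ t ∈ s, Θ * d t / (k * D) ≤ (∑ t ∈ s, Θ * d t) / (k * D) := sum_div_le_sum_div s _ _
    _ ≤ (∑ t ∈ univ, Θ * d t) / (k * D) := Nat.div_le_div_right (Finset.sum_le_sum_of_subset hs)
    _ = (Θ * D) / (k * D) := by rw [← Finset.mul_sum, hD]
    _ = Θ / k := by
        rcases Nat.eq_zero_or_pos k with hk | hk
        · subst hk; simp
        · rw [mul_comm k D, ← Nat.div_div_eq_div_mul, Nat.mul_div_cancel _ hDpos]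

/-! ## (A2) the number of fat blocks -/

/-- **(A2) Few fat blocks.**  If every `t ∈ s` is fat (`M ≤ d t`) then `M · #s ≤ Σ_{t ∈ s} d t` (`≤ D` for a subfamily of the blocks). -/
theorem card_mul_le_sum_of_le {ι : Type*} (s : Finset ι) (d : ι → ℕ) (M : ℕ) (hfat : ∀ t ∈ s, M ≤ d t) :
    M * s.card ≤ ∑ t ∈ s, d t := by
  rw [mul_comm, Finset.card_eq_sum_ones, Finset.sum_mul]
  exact Finset.sum_le_sum fun t ht => by simpa using hfat t ht

/-- (A2) in the threshold currency `4D ≤ Θ·d t`: `4D·#fat ≤ Θ·Σ_{fat} d t ≤ Θ·D`. -/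
theorem card_fat_le {ι : Type*} (s univ : Finset ι) (hs : s ⊆ univ) (d : ι → ℕ) (D Θ : ℕ)
    (hD : ∑ t ∈ univ, d t = D) (hfat : ∀ t ∈ s, 4 * D ≤ Θ * d t) :
    4 * D * s.card ≤ Θ * D := by
  calc 4 * D * s.card ≤ ∑ t ∈ s, Θ * d t := card_mul_le_sum_of_le s (fun t => Θ * d t) (4 * D) hfat
    _ ≤ ∑ t ∈ univ, Θ * d t := Finset.sum_le_sum_of_subset hs
    _ = Θ * D := by rw [← Finset.mul_sum, hD]

/-! ## (A3) the cost of a certified block -/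

/-- **(A3) Certified cost.**  If `Θ_t := Θ·d/(4D)` (so `Θ·d < 4D·(Θ_t + 1)`), `1 ≤ Θ_t` and `Θ_t · c ≤ C · d²`, then `Θ · c ≤ 8·C·D·d`. -/
theorem certified_cost (Θ d D C c : ℕ) (hΘt : 1 ≤ Θ * d / (4 * D)) (hlaw : Θ * d / (4 * D) * c ≤ C * d ^ 2) :
    Θ * c ≤ 8 * C * D * d := by
  set q := Θ * d / (4 * D) with hq
  have hDpos : 0 < 4 * D := by
    rcases Nat.eq_zero_or_pos (4 * D) with h0 | h0
    · rw [h0, Nat.div_zero] at hq; omega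
    · exact h0
  -- Θ d < 4D (q+1) ≤ 8 D q
  have h1 : Θ * d < 4 * D * (q + 1) := by
    have := Nat.lt_div_mul_add (a := Θ * d) hDpos
    rw [← hq] at this
    linarith [Nat.div_add_mod (Θ * d) (4 * D)]
  have h2 : Θ * d ≤ 8 * D * q := by nlinarith
  -- Θ c d ≤ 8 D q c ≤ 8 D C d²
  rcases Nat.eq_zero_or_pos d with hd | hd
  · subst hd
    rw [hq, mul_zero, Nat.zero_div] at hΘt
    omega
  have h3 : Θ * c * d ≤ 8 * D * C * d ^ 2 := by
    calc Θ * c * d = (Θ * d) * c := by ring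
      _ ≤ (8 * D * q) * c := Nat.mul_le_mul_right c h2
      _ = 8 * D * (q * c) := by ring
      _ ≤ 8 * D * (C * d ^ 2) := Nat.mul_le_mul_left _ hlaw
      _ = 8 * D * C * d ^ 2 := by ring
  have h4 : Θ * c * d ≤ (8 * C * D * d) * d := by
    calc Θ * c * d ≤ 8 * D * C * d ^ 2 := h3
      _ = (8 * C * D * d) * d := by ring
  exact Nat.le_of_mul_le_mul_right h4 hd

/-! ## (A4) the cost of the kill groups -/

/-- **(A4) Kill cost.**  Groups of size `< B` have `Σ g² ≤ B · Σ g` (indeed `≤ (B−1)·Σ g`). -/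
theorem sum_sq_le_of_lt {ι : Type*} (s : Finset ι) (g : ι → ℕ) (B : ℕ) (hg : ∀ i ∈ s, g i < B) :
    ∑ i ∈ s, g i ^ 2 ≤ B * ∑ i ∈ s, g i := by
  rw [Finset.mul_sum]
  exact Finset.sum_le_sum fun i hi => by
    have := hg i hi
    nlinarith

/-- (A4) in the threshold currency: groups of size `g` with `Θ·g < 8D` cost `Θ·Σ g² ≤ 8D·Σ g` (`≤ 8D²` for a partition of `D`). -/
theorem kill_cost {ι : Type*} (s : Finset ι) (g : ι → ℕ) (D Θ : ℕ) (hg : ∀ i ∈ s, Θ * g i < 8 * D) :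
    Θ * ∑ i ∈ s, g i ^ 2 ≤ 8 * D * ∑ i ∈ s, g i := by
  rw [Finset.mul_sum, Finset.mul_sum]
  exact Finset.sum_le_sum fun i hi => by
    have := hg i hi
    nlinarith

end Summit.ValiantsHypothesis.ValiantsHypothesis.Theorems.GrenetZeon.HalfSpeed
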